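import Literature.MathematicalPhysics.QuantumLattice.WilsonHoppingAlgebra
import HarnessLib

/-!
# Neuberger's bound on the Wilson–Dirac operator, II: the abstract lower bound

Topic `Literature/MathematicalPhysics/QuantumLattice`; namespace
`Literature.MathematicalPhysics.QuantumLattice.NeubergerBound`.  Continuation of
`WilsonHoppingAlgebra.lean` [Neuberger2000Bounds, §"Lower bound"].

With `e_μ := v − W_μ v` one has `D v = m v + Σ_μ e_μ` and, `W_μ` being unitary,
`2 Re⟨v, e_μ⟩ = ‖e_μ‖²`, whence the quadratic-form version of Neuberger's explicit formula
`H_W² = m² + 2(m+1)Σ_μ(1−h_μ) + Σ_{μ≠ν}[(1−h_μ)(1−h_ν) − a_μa_ν − [a_μ,h_ν]]`: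
`‖D v‖² = m²‖v‖² + (m+1)Σ_μ‖e_μ‖² + Σ_{μ≠ν} Re⟨e_μ, e_ν⟩` (`eucNorm_sq_smul_add_sum`).
Writing `2e_μ = (K_μ ⊗ 1)v − (Δ_μ ⊗ 1)(1 ⊗ γ_μ)v`, each ordered pair `μ ≠ ν` contributes
`Re⟨2e_μ, 2e_ν⟩ ≥ −(4 + 2 + 2 + 2)δ‖v‖²` (the `Q+X`, `Z`, `Z`, `Y` terms of the paper; the `Y`
term uses `γ_μγ_ν = −γ_νγ_μ`, the `Z` terms `γ_μᴴ = γ_μ`, and colour-space bounds are lifted through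
`⊗ 1_spin` slice by slice), so `‖D v‖² ≥ (m² − 12·(5/2)δ)‖v‖² = (m² − 30δ)‖v‖²` for `m ≥ −1`
(`sq_sub_thirty_mul_le_eucNorm_sq_hoppingOp_mulVec`).  The printed constant `(2+√2)Σ_{μ>ν}ε_{μν}`
is sharper; any explicit constant serves the tree's consumers.

Reference: H. Neuberger, *Bounds on the Wilson Dirac operator*, Phys. Rev. D 61 (2000) 085015,
arXiv:hep-lat/9911004, §"Lower bound". [Neuberger2000Bounds]
-/

noncomputable section

open Matrix Finset
open scoped Kronecker ComplexOrder

namespace Literature.MathematicalPhysics.QuantumLattice.NeubergerBound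

section KroneckerLift

variable {n : Type*} [Fintype n] [DecidableEq n]

/-- `2 Re ⟨v, P v⟩ = Re ⟨v, (P + Pᴴ) v⟩`. [folklore] -/
theorem two_mul_re_star_dotProduct_mulVec {k : Type*} [Fintype k] (P : Matrix k k ℂ)
    (v : k → ℂ) : 2 * (star v ⬝ᵥ (P *ᵥ v)).re = (star v ⬝ᵥ ((P + Pᴴ) *ᵥ v)).re := by
  rw [add_mulVec, dotProduct_add, Complex.add_re, re_star_dotProduct_conjTranspose_mulVec, two_mul]

/-- Hermitian × anti-Hermitian cross term: `P + Pᴴ = ([X, Y] ⊗ 1)(1 ⊗ Γ)` for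
`P = (X ⊗ 1)ᴴ (Y ⊗ 1)(1 ⊗ Γ)`, `Xᴴ = X`, `Yᴴ = -Y`, `Γᴴ = Γ`. [folklore] -/
theorem herm_antiherm_cross_add_conjTranspose (X Y : Matrix n n ℂ) (Γ : Matrix (Fin 4) (Fin 4) ℂ)
    (hX : Xᴴ = X) (hY : Yᴴ = -Y) (hΓ : Γᴴ = Γ) :
    (X ⊗ₖ (1 : Matrix (Fin 4) (Fin 4) ℂ))ᴴ *
          ((Y ⊗ₖ (1 : Matrix (Fin 4) (Fin 4) ℂ)) * ((1 : Matrix n n ℂ) ⊗ₖ Γ)) +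
        ((X ⊗ₖ (1 : Matrix (Fin 4) (Fin 4) ℂ))ᴴ *
          ((Y ⊗ₖ (1 : Matrix (Fin 4) (Fin 4) ℂ)) * ((1 : Matrix n n ℂ) ⊗ₖ Γ)))ᴴ =
      ((X * Y - Y * X) ⊗ₖ (1 : Matrix (Fin 4) (Fin 4) ℂ)) * ((1 : Matrix n n ℂ) ⊗ₖ Γ) := by
  have hP : (X ⊗ₖ (1 : Matrix (Fin 4) (Fin 4) ℂ))ᴴ *
      ((Y ⊗ₖ (1 : Matrix (Fin 4) (Fin 4) ℂ)) * ((1 : Matrix n n ℂ) ⊗ₖ Γ)) = (X * Y) ⊗ₖ Γ := by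
    rw [conjTranspose_kronecker, conjTranspose_one, hX, ← mul_kronecker_mul, mul_one, one_mul,
      ← mul_kronecker_mul, one_mul]
  rw [hP, conjTranspose_kronecker, conjTranspose_mul, hX, hY, hΓ, ← mul_kronecker_mul, mul_one,
    one_mul, ← add_kronecker, neg_mul, ← sub_eq_add_neg]

/-- Anti-Hermitian × anti-Hermitian term with anticommuting spin matrices:
`Q + Qᴴ = -([Y, Y'] ⊗ 1)(1 ⊗ ΓΓ')` for `Q = ((Y ⊗ 1)(1 ⊗ Γ))ᴴ (Y' ⊗ 1)(1 ⊗ Γ')`. [folklore] -/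
theorem antiherm_antiherm_cross_add_conjTranspose (Y Y' : Matrix n n ℂ)
    (Γ Γ' : Matrix (Fin 4) (Fin 4) ℂ) (hY : Yᴴ = -Y) (hY' : Y'ᴴ = -Y') (hΓ : Γᴴ = Γ)
    (hΓ' : Γ'ᴴ = Γ') (hac : Γ' * Γ = -(Γ * Γ')) :
    ((Y ⊗ₖ (1 : Matrix (Fin 4) (Fin 4) ℂ)) * ((1 : Matrix n n ℂ) ⊗ₖ Γ))ᴴ *
          ((Y' ⊗ₖ (1 : Matrix (Fin 4) (Fin 4) ℂ)) * ((1 : Matrix n n ℂ) ⊗ₖ Γ')) +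
        (((Y ⊗ₖ (1 : Matrix (Fin 4) (Fin 4) ℂ)) * ((1 : Matrix n n ℂ) ⊗ₖ Γ))ᴴ *
          ((Y' ⊗ₖ (1 : Matrix (Fin 4) (Fin 4) ℂ)) * ((1 : Matrix n n ℂ) ⊗ₖ Γ')))ᴴ =
      -(((Y * Y' - Y' * Y) ⊗ₖ (1 : Matrix (Fin 4) (Fin 4) ℂ)) *
        ((1 : Matrix n n ℂ) ⊗ₖ (Γ * Γ'))) := by
  have hQ : ((Y ⊗ₖ (1 : Matrix (Fin 4) (Fin 4) ℂ)) * ((1 : Matrix n n ℂ) ⊗ₖ Γ))ᴴ *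
      ((Y' ⊗ₖ (1 : Matrix (Fin 4) (Fin 4) ℂ)) * ((1 : Matrix n n ℂ) ⊗ₖ Γ')) =
        ((-Y) * Y') ⊗ₖ (Γ * Γ') := by
    rw [← mul_kronecker_mul, mul_one, one_mul, ← mul_kronecker_mul, mul_one, one_mul,
      conjTranspose_kronecker, hY, hΓ, ← mul_kronecker_mul]
  rw [hQ, conjTranspose_kronecker, conjTranspose_mul, conjTranspose_mul, conjTranspose_neg, hY, hY',
    hΓ, hΓ', hac, neg_neg, ← mul_kronecker_mul, mul_one, one_mul]
  ext ⟨i, a⟩ ⟨j, b⟩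
  simp only [Matrix.add_apply, kroneckerMap_apply, Matrix.neg_apply, Matrix.sub_apply,
    Matrix.neg_mul]
  ring

omit [DecidableEq n] in
/-- Slices of `(C ⊗ 1) u`. [folklore] -/
theorem kronecker_one_mulVec_slice (C : Matrix n n ℂ) (u : n × Fin 4 → ℂ) (α : Fin 4) :
    (fun p => ((C ⊗ₖ (1 : Matrix (Fin 4) (Fin 4) ℂ)) *ᵥ u) (p, α)) = C *ᵥ fun p => u (p, α) :=
  funext fun p => kronecker_one_mulVec_apply C u p α

omit [DecidableEq n] in
/-- **Lifting a colour-space bound through `⊗ 1_spin`**: if `‖C w‖ ≤ c‖w‖` for all `w` supported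
in `S`, then `‖(C ⊗ 1) u‖ ≤ c‖u‖` for all `u` site-supported in `S`. [folklore] -/
theorem eucNorm_kronecker_one_mulVec_le {S : n → Prop} {C : Matrix n n ℂ} {c : ℝ} (hc : 0 ≤ c)
    (h : ∀ w : n → ℂ, (∀ p, w p ≠ 0 → S p) → eucNorm (C *ᵥ w) ≤ c * eucNorm w)
    (u : n × Fin 4 → ℂ) (hu : ∀ p α, u (p, α) ≠ 0 → S p) :
    eucNorm ((C ⊗ₖ (1 : Matrix (Fin 4) (Fin 4) ℂ)) *ᵥ u) ≤ c * eucNorm u := by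
  have hsq : eucNorm ((C ⊗ₖ (1 : Matrix (Fin 4) (Fin 4) ℂ)) *ᵥ u) ^ 2 ≤ (c * eucNorm u) ^ 2 := by
    rw [eucNorm_sq_eq_sum_slices, mul_pow, eucNorm_sq_eq_sum_slices u, Finset.mul_sum]
    refine Finset.sum_le_sum fun α _ => ?_
    rw [kronecker_one_mulVec_slice, ← mul_pow]
    have hα := h (fun p => u (p, α)) (fun p hp => hu p α hp)
    exact pow_le_pow_left₀ (eucNorm_nonneg _) hα 2
  exact (pow_le_pow_iff_left₀ (eucNorm_nonneg _) (mul_nonneg hc (eucNorm_nonneg _))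
    two_ne_zero).mp hsq

/-- `(1 ⊗ Γ) u` is site-supported where `u` is. [folklore] -/
theorem support_one_kronecker_mulVec {S : n → Prop} (Γ : Matrix (Fin 4) (Fin 4) ℂ)
    (u : n × Fin 4 → ℂ) (hu : ∀ p α, u (p, α) ≠ 0 → S p) (p : n) (α : Fin 4)
    (h : (((1 : Matrix n n ℂ) ⊗ₖ Γ) *ᵥ u) (p, α) ≠ 0) : S p := by
  by_contra hS
  apply h
  rw [one_kronecker_mulVec_apply]
  have : (fun β => u (p, β)) = 0 := funext fun β => by
    by_contra hβ
    exact hS (hu p β hβ)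
  rw [this, mulVec_zero, Pi.zero_apply]

/-- `‖(1 ⊗ Γ) u‖ = ‖u‖` for `Γᴴ Γ = 1`. [folklore] -/
theorem eucNorm_one_kronecker_mulVec (Γ : Matrix (Fin 4) (Fin 4) ℂ) (hΓ : Γᴴ * Γ = 1)
    (u : n × Fin 4 → ℂ) : eucNorm (((1 : Matrix n n ℂ) ⊗ₖ Γ) *ᵥ u) = eucNorm u := by
  refine eucNorm_mulVec_of_conjTranspose_mul_self ?_ u
  rw [conjTranspose_kronecker, conjTranspose_one, ← mul_kronecker_mul, one_mul, hΓ,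
    one_kronecker_one]

end KroneckerLift

section PairBound

variable {n : Type*} [Fintype n] [DecidableEq n] (F : Fin 4 → Matrix n n ℂ)


variable {S : n → Prop} {δ : ℝ}

omit [Fintype n] [DecidableEq n] in
/-- `Δ_μ` is anti-Hermitian. [folklore] -/
theorem conjTranspose_delta (μ : Fin 4) : (((F μ)ᴴ - F μ))ᴴ = -((F μ)ᴴ - F μ) := by
  rw [conjTranspose_sub, conjTranspose_conjTranspose, neg_sub]

/-- `γ_μᴴ γ_μ = 1`. [folklore] -/
theorem conjTranspose_euclideanGamma_mul_self (μ : Fin 4) :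
    (euclideanGamma μ)ᴴ * euclideanGamma μ = 1 := by
  rw [(euclideanGamma_isHermitian μ).eq, euclideanGamma_mul_self]

/-- `(γ_μ γ_ν)ᴴ (γ_μ γ_ν) = 1`. [folklore] -/
theorem conjTranspose_gamma_mul_gamma_mul_self (μ ν : Fin 4) :
    (euclideanGamma μ * euclideanGamma ν)ᴴ * (euclideanGamma μ * euclideanGamma ν) = 1 := by
  rw [conjTranspose_mul, (euclideanGamma_isHermitian μ).eq, (euclideanGamma_isHermitian ν).eq,
    mul_assoc, ← mul_assoc (euclideanGamma μ), euclideanGamma_mul_self, one_mul,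
    euclideanGamma_mul_self]

/-- The `h`–`h` term: `Re ⟨(K_μ ⊗ 1) v, (K_ν ⊗ 1) v⟩ ≥ −4δ‖v‖²` (slice by slice).
[cite: Neuberger2000Bounds, §Lower bound] -/
theorem re_KX_KX_ge (hF : ∀ μ, (F μ)ᴴ * F μ = 1) (hF' : ∀ μ, F μ * (F μ)ᴴ = 1)

    (hC : ∀ w : n → ℂ, (∀ p, w p ≠ 0 → S p) → ∀ μ ν : Fin 4, μ ≠ ν →
      eucNorm ((F μ * F ν - F ν * F μ) *ᵥ w) ≤ δ * eucNorm w ∧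
      eucNorm ((F μ * (F ν)ᴴ - (F ν)ᴴ * F μ) *ᵥ w) ≤ δ * eucNorm w ∧
      eucNorm (((F μ)ᴴ * (F ν)ᴴ - (F ν)ᴴ * (F μ)ᴴ) *ᵥ w) ≤ δ * eucNorm w)
    {μ ν : Fin 4} (hμν : μ ≠ ν) (v : n × Fin 4 → ℂ)
    (hv : ∀ p α, v (p, α) ≠ 0 → S p) :
    -(4 * (δ * eucNorm v ^ 2)) ≤
      (star (((1 - F μ + (1 - (F μ)ᴴ)) ⊗ₖ (1 : Matrix (Fin 4) (Fin 4) ℂ)) *ᵥ v) ⬝ᵥ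
        (((1 - F ν + (1 - (F ν)ᴴ)) ⊗ₖ (1 : Matrix (Fin 4) (Fin 4) ℂ)) *ᵥ v)).re := by
  rw [star_dotProduct_eq_sum_slices, Complex.re_sum, eucNorm_sq_eq_sum_slices v, Finset.mul_sum,
    Finset.mul_sum, ← Finset.sum_neg_distrib]
  refine Finset.sum_le_sum fun α _ => ?_
  rw [kronecker_one_mulVec_slice, kronecker_one_mulVec_slice]
  exact re_star_dotProduct_K_mulVec_K_mulVec_ge F hF hF' hC hμν _ fun p hp => hv p α hp

/-- The `h`–`a` cross term (`Z`): `|2 Re ⟨(K_μ ⊗ 1) v, (Δ_ν ⊗ 1)(1 ⊗ γ_ν) v⟩| ≤ 4δ‖v‖²`.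
[cite: Neuberger2000Bounds, §Lower bound] -/
theorem abs_two_mul_re_KX_DX_le
    (hC : ∀ w : n → ℂ, (∀ p, w p ≠ 0 → S p) → ∀ μ ν : Fin 4, μ ≠ ν →
      eucNorm ((F μ * F ν - F ν * F μ) *ᵥ w) ≤ δ * eucNorm w ∧
      eucNorm ((F μ * (F ν)ᴴ - (F ν)ᴴ * F μ) *ᵥ w) ≤ δ * eucNorm w ∧
      eucNorm (((F μ)ᴴ * (F ν)ᴴ - (F ν)ᴴ * (F μ)ᴴ) *ᵥ w) ≤ δ * eucNorm w)
    (hδ : 0 ≤ δ) {μ ν : Fin 4} (hμν : μ ≠ ν)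
    (v : n × Fin 4 → ℂ) (hv : ∀ p α, v (p, α) ≠ 0 → S p) :
    |2 * (star (((1 - F μ + (1 - (F μ)ᴴ)) ⊗ₖ (1 : Matrix (Fin 4) (Fin 4) ℂ)) *ᵥ v) ⬝ᵥ
        ((((F ν)ᴴ - F ν) ⊗ₖ (1 : Matrix (Fin 4) (Fin 4) ℂ)) *ᵥ
          (((1 : Matrix n n ℂ) ⊗ₖ euclideanGamma ν) *ᵥ v))).re| ≤ 4 * (δ * eucNorm v ^ 2) := by
  rw [star_mulVec, ← dotProduct_mulVec, mulVec_mulVec, mulVec_mulVec, mul_assoc,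
    two_mul_re_star_dotProduct_mulVec,
    herm_antiherm_cross_add_conjTranspose _ _ _ (conjTranspose_K F μ) (conjTranspose_delta F ν)
      (euclideanGamma_isHermitian ν).eq, ← mulVec_mulVec]
  refine (abs_re_star_dotProduct_le _ _).trans ?_
  have hg := support_one_kronecker_mulVec (euclideanGamma ν) v hv
  have hlift := eucNorm_kronecker_one_mulVec_le (S := S)
    (C := (1 - F μ + (1 - (F μ)ᴴ)) * ((F ν)ᴴ - F ν) - ((F ν)ᴴ - F ν) * (1 - F μ + (1 - (F μ)ᴴ)))
    (c := 4 * δ) (by positivity)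
    (fun w hw => by rw [mul_assoc]; exact eucNorm_K_comm_delta_mulVec_le F hC hμν w hw) _ hg
  rw [eucNorm_one_kronecker_mulVec _ (conjTranspose_euclideanGamma_mul_self ν)] at hlift
  calc _ ≤ eucNorm v * (4 * δ * eucNorm v) := by gcongr; exact eucNorm_nonneg _
    _ = _ := by ring

/-- The `a`–`a` term (`Y`, using `γ_μγ_ν = −γ_νγ_μ`):
`|2 Re ⟨(Δ_μ ⊗ γ_μ) v, (Δ_ν ⊗ γ_ν) v⟩| ≤ 4δ‖v‖²`. [cite: Neuberger2000Bounds, §Lower bound] -/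
theorem abs_two_mul_re_DX_DX_le
    (hC : ∀ w : n → ℂ, (∀ p, w p ≠ 0 → S p) → ∀ μ ν : Fin 4, μ ≠ ν →
      eucNorm ((F μ * F ν - F ν * F μ) *ᵥ w) ≤ δ * eucNorm w ∧
      eucNorm ((F μ * (F ν)ᴴ - (F ν)ᴴ * F μ) *ᵥ w) ≤ δ * eucNorm w ∧
      eucNorm (((F μ)ᴴ * (F ν)ᴴ - (F ν)ᴴ * (F μ)ᴴ) *ᵥ w) ≤ δ * eucNorm w)
    (hδ : 0 ≤ δ) {μ ν : Fin 4} (hμν : μ ≠ ν)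
    (v : n × Fin 4 → ℂ) (hv : ∀ p α, v (p, α) ≠ 0 → S p) :
    |2 * (star ((((F μ)ᴴ - F μ) ⊗ₖ (1 : Matrix (Fin 4) (Fin 4) ℂ)) *ᵥ
          (((1 : Matrix n n ℂ) ⊗ₖ euclideanGamma μ) *ᵥ v)) ⬝ᵥ
        ((((F ν)ᴴ - F ν) ⊗ₖ (1 : Matrix (Fin 4) (Fin 4) ℂ)) *ᵥ
          (((1 : Matrix n n ℂ) ⊗ₖ euclideanGamma ν) *ᵥ v))).re| ≤
      4 * (δ * eucNorm v ^ 2) := by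
  rw [mulVec_mulVec, mulVec_mulVec, star_mulVec, ← dotProduct_mulVec, mulVec_mulVec,
    two_mul_re_star_dotProduct_mulVec,
    antiherm_antiherm_cross_add_conjTranspose _ _ _ _ (conjTranspose_delta F μ)
      (conjTranspose_delta F ν)
      (euclideanGamma_isHermitian μ).eq (euclideanGamma_isHermitian ν).eq
      (euclideanGamma_mul_of_ne hμν.symm), neg_mulVec, dotProduct_neg, Complex.neg_re, abs_neg,
    ← mulVec_mulVec]
  refine (abs_re_star_dotProduct_le _ _).trans ?_
  have hg := support_one_kronecker_mulVec (euclideanGamma μ * euclideanGamma ν) v hv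
  have hlift := eucNorm_kronecker_one_mulVec_le (S := S)
    (C := ((F μ)ᴴ - F μ) * ((F ν)ᴴ - F ν) - ((F ν)ᴴ - F ν) * ((F μ)ᴴ - F μ))
    (c := 4 * δ) (by positivity)
    (fun w hw => by rw [mul_assoc]; exact eucNorm_delta_comm_delta_mulVec_le F hC hμν w hw) _ hg
  rw [eucNorm_one_kronecker_mulVec _ (conjTranspose_gamma_mul_gamma_mul_self μ ν)] at hlift
  calc _ ≤ eucNorm v * (4 * δ * eucNorm v) := by gcongr; exact eucNorm_nonneg _
    _ = _ := by ring

/-- **Per-pair bound**: for `μ ≠ ν`, `Re ⟨e_μ, e_ν⟩ ≥ −10δ‖v‖²` where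
`e_μ = (K_μ ⊗ 1)v − (Δ_μ ⊗ 1)(1 ⊗ γ_μ)v = 2(1 − W_μ)v`. [cite: Neuberger2000Bounds, §Lower bound] -/
theorem re_pair_ge (hF : ∀ μ, (F μ)ᴴ * F μ = 1) (hF' : ∀ μ, F μ * (F μ)ᴴ = 1)

    (hC : ∀ w : n → ℂ, (∀ p, w p ≠ 0 → S p) → ∀ μ ν : Fin 4, μ ≠ ν →
      eucNorm ((F μ * F ν - F ν * F μ) *ᵥ w) ≤ δ * eucNorm w ∧
      eucNorm ((F μ * (F ν)ᴴ - (F ν)ᴴ * F μ) *ᵥ w) ≤ δ * eucNorm w ∧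
      eucNorm (((F μ)ᴴ * (F ν)ᴴ - (F ν)ᴴ * (F μ)ᴴ) *ᵥ w) ≤ δ * eucNorm w)
    (hδ : 0 ≤ δ) {μ ν : Fin 4} (hμν : μ ≠ ν) (v : n × Fin 4 → ℂ)
    (hv : ∀ p α, v (p, α) ≠ 0 → S p) :
    -(10 * (δ * eucNorm v ^ 2)) ≤
      (star (((1 - F μ + (1 - (F μ)ᴴ)) ⊗ₖ (1 : Matrix (Fin 4) (Fin 4) ℂ)) *ᵥ v -
          (((F μ)ᴴ - F μ) ⊗ₖ (1 : Matrix (Fin 4) (Fin 4) ℂ)) *ᵥ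
            (((1 : Matrix n n ℂ) ⊗ₖ euclideanGamma μ) *ᵥ v)) ⬝ᵥ
        (((1 - F ν + (1 - (F ν)ᴴ)) ⊗ₖ (1 : Matrix (Fin 4) (Fin 4) ℂ)) *ᵥ v -
          (((F ν)ᴴ - F ν) ⊗ₖ (1 : Matrix (Fin 4) (Fin 4) ℂ)) *ᵥ
            (((1 : Matrix n n ℂ) ⊗ₖ euclideanGamma ν) *ᵥ v))).re := by
  have hkk := re_KX_KX_ge F hF hF' hC hμν v hv
  have hka := abs_two_mul_re_KX_DX_le F hC hδ hμν v hv
  have hak := abs_two_mul_re_KX_DX_le F hC hδ hμν.symm v hv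
  have haa := abs_two_mul_re_DX_DX_le F hC hδ hμν v hv
  have hswap : (star ((((F μ)ᴴ - F μ) ⊗ₖ (1 : Matrix (Fin 4) (Fin 4) ℂ)) *ᵥ
        (((1 : Matrix n n ℂ) ⊗ₖ euclideanGamma μ) *ᵥ v)) ⬝ᵥ
          (((1 - F ν + (1 - (F ν)ᴴ)) ⊗ₖ (1 : Matrix (Fin 4) (Fin 4) ℂ)) *ᵥ v)).re =
      (star (((1 - F ν + (1 - (F ν)ᴴ)) ⊗ₖ (1 : Matrix (Fin 4) (Fin 4) ℂ)) *ᵥ v) ⬝ᵥ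
        ((((F μ)ᴴ - F μ) ⊗ₖ (1 : Matrix (Fin 4) (Fin 4) ℂ)) *ᵥ
          (((1 : Matrix n n ℂ) ⊗ₖ euclideanGamma μ) *ᵥ v))).re := by
    rw [star_dotProduct, Complex.star_def, Complex.conj_re]
  rw [star_sub, sub_dotProduct, dotProduct_sub, dotProduct_sub, Complex.sub_re, Complex.sub_re,
    Complex.sub_re, hswap]
  rw [abs_le] at hka hak haa
  linarith [hka.1, hka.2, hak.1, hak.2, haa.1, haa.2]

end PairBound

section SquareIdentity

variable {k : Type*} [Fintype k]

/-- **Polarisation bookkeeping**: if `2 Re ⟨v, e_μ⟩ = ‖e_μ‖²` for each `μ`, then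
`‖m v + Σ_μ e_μ‖² = m²‖v‖² + (m + 1) Σ_μ ‖e_μ‖² + Σ_{μ ≠ ν} Re ⟨e_μ, e_ν⟩`. [folklore] -/
theorem eucNorm_sq_smul_add_sum (v : k → ℂ) (e : Fin 4 → k → ℂ) (m : ℝ)
    (h : ∀ μ, 2 * (star v ⬝ᵥ e μ).re = eucNorm (e μ) ^ 2) :
    eucNorm ((m : ℂ) • v + ∑ μ, e μ) ^ 2 =
      m ^ 2 * eucNorm v ^ 2 + (m + 1) * ∑ μ, eucNorm (e μ) ^ 2 +
        ∑ μ, ∑ ν ∈ univ.erase μ, (star (e μ) ⬝ᵥ e ν).re := by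
  have hstar : star ((m : ℂ) • v + ∑ μ, e μ) = (m : ℂ) • star v + ∑ μ, star (e μ) := by
    rw [star_add, star_smul, star_sum, Complex.star_def, Complex.conj_ofReal]
  rw [eucNorm_sq, hstar]
  simp only [add_dotProduct, dotProduct_add, smul_dotProduct, dotProduct_smul, sum_dotProduct,
    dotProduct_sum, smul_eq_mul]
  simp only [Complex.add_re, Complex.re_sum, Complex.mul_re, Complex.ofReal_re, Complex.ofReal_im,
    zero_mul, sub_zero]
  have hsym : ∀ μ, (star (e μ) ⬝ᵥ v).re = (star v ⬝ᵥ e μ).re := fun μ => by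
    rw [star_dotProduct, Complex.star_def, Complex.conj_re]
  have hdiag : ∀ μ, (star (e μ) ⬝ᵥ e μ).re = eucNorm (e μ) ^ 2 := fun μ =>
    re_star_dotProduct_self _
  have hsplit : ∑ μ, ∑ ν, (star (e μ) ⬝ᵥ e ν).re =
      ∑ μ, eucNorm (e μ) ^ 2 + ∑ μ, ∑ ν ∈ univ.erase μ, (star (e μ) ⬝ᵥ e ν).re := by
    rw [← Finset.sum_add_distrib]
    refine Finset.sum_congr rfl fun μ _ => ?_
    rw [← Finset.add_sum_erase _ _ (Finset.mem_univ μ), hdiag]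
  have hh : ∀ μ, (star v ⬝ᵥ e μ).re = eucNorm (e μ) ^ 2 / 2 := fun μ => by linarith [h μ]
  simp only [hsym, hh, re_star_dotProduct_self]
  rw [Finset.sum_add_distrib, Finset.sum_comm, hsplit, ← Finset.mul_sum, ← Finset.sum_div]
  ring

/-- For an isometry `A` (`AᴴA = 1`): `‖v - A v‖² = 2 Re ⟨v, v - A v⟩`. [folklore] -/
theorem eucNorm_sq_sub_isometry_mulVec [DecidableEq k] (A : Matrix k k ℂ) (hA : Aᴴ * A = 1)
    (v : k → ℂ) : 2 * (star v ⬝ᵥ (v - A *ᵥ v)).re = eucNorm (v - A *ᵥ v) ^ 2 := by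
  have hiso : star (A *ᵥ v) ⬝ᵥ (A *ᵥ v) = star v ⬝ᵥ v := by
    rw [star_mulVec, ← dotProduct_mulVec, mulVec_mulVec, hA, one_mulVec]
  have hsym : (star (A *ᵥ v) ⬝ᵥ v).re = (star v ⬝ᵥ (A *ᵥ v)).re := by
    rw [star_dotProduct, Complex.star_def, Complex.conj_re]
  simp only [eucNorm_sq, star_sub, sub_dotProduct, dotProduct_sub, hiso, Complex.sub_re, hsym]
  ring

end SquareIdentity

section MainAbstract

variable {n : Type*} [Fintype n] [DecidableEq n] (F : Fin 4 → Matrix n n ℂ)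


variable {S : n → Prop} {δ : ℝ}

/-- The scaled defect vector: `2 (v − W_μ v) = (K_μ ⊗ 1) v − (Δ_μ ⊗ 1)(1 ⊗ γ_μ) v`. [folklore] -/
theorem two_smul_sub_Wk_mulVec (μ : Fin 4) (v : n × Fin 4 → ℂ) :
    (2 : ℂ) • (v - (F μ ⊗ₖ chiralProjMinus μ + (F μ)ᴴ ⊗ₖ chiralProjPlus μ) *ᵥ v) =
      ((1 - F μ + (1 - (F μ)ᴴ)) ⊗ₖ (1 : Matrix (Fin 4) (Fin 4) ℂ)) *ᵥ v -
        (((F μ)ᴴ - F μ) ⊗ₖ (1 : Matrix (Fin 4) (Fin 4) ℂ)) *ᵥ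
          (((1 : Matrix n n ℂ) ⊗ₖ euclideanGamma μ) *ᵥ v) := by
  have h := congrArg (fun M : Matrix (n × Fin 4) (n × Fin 4) ℂ => M *ᵥ v) (two_smul_one_sub_Wk F μ)
  simp only [smul_mulVec, sub_mulVec, one_mulVec] at h
  rw [h, mulVec_mulVec]

/-- Per-pair bound for the unscaled defect vectors `e_μ = v - W_μ v`:
`Re ⟨e_μ, e_ν⟩ ≥ −(5/2) δ ‖v‖²` for `μ ≠ ν`. [cite: Neuberger2000Bounds, §Lower bound] -/
theorem re_sub_Wk_pair_ge (hF : ∀ μ, (F μ)ᴴ * F μ = 1) (hF' : ∀ μ, F μ * (F μ)ᴴ = 1)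

    (hC : ∀ w : n → ℂ, (∀ p, w p ≠ 0 → S p) → ∀ μ ν : Fin 4, μ ≠ ν →
      eucNorm ((F μ * F ν - F ν * F μ) *ᵥ w) ≤ δ * eucNorm w ∧
      eucNorm ((F μ * (F ν)ᴴ - (F ν)ᴴ * F μ) *ᵥ w) ≤ δ * eucNorm w ∧
      eucNorm (((F μ)ᴴ * (F ν)ᴴ - (F ν)ᴴ * (F μ)ᴴ) *ᵥ w) ≤ δ * eucNorm w)
    (hδ : 0 ≤ δ) {μ ν : Fin 4} (hμν : μ ≠ ν) (v : n × Fin 4 → ℂ)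
    (hv : ∀ p α, v (p, α) ≠ 0 → S p) :
    -(5 / 2 * (δ * eucNorm v ^ 2)) ≤
      (star (v - (F μ ⊗ₖ chiralProjMinus μ + (F μ)ᴴ ⊗ₖ chiralProjPlus μ) *ᵥ v) ⬝ᵥ
        (v - (F ν ⊗ₖ chiralProjMinus ν + (F ν)ᴴ ⊗ₖ chiralProjPlus ν) *ᵥ v)).re := by
  have h := re_pair_ge F hF hF' hC hδ hμν v hv
  rw [← two_smul_sub_Wk_mulVec, ← two_smul_sub_Wk_mulVec, star_smul, smul_dotProduct,
    dotProduct_smul, smul_smul, Complex.star_def, Complex.conj_ofNat, smul_eq_mul,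
    show (2 : ℂ) * 2 = ((4 : ℝ) : ℂ) by norm_num, Complex.re_ofReal_mul] at h
  linarith

/-- **Abstract Neuberger lower bound.**  For four unitaries `F_μ` on `ℂⁿ` whose mixed
commutators `[F_μ^{(†)}, F_ν^{(†)}]`, `μ ≠ ν`, are `δ`-small on vectors supported in `S`, the
operator `D = (m + 4)·1 − Σ_μ (F_μ ⊗ P⁻_μ + F_μᴴ ⊗ P⁺_μ)` satisfies
`‖D v‖² ≥ (m² − 30 δ)‖v‖²` for every `m ≥ −1` and every `v` site-supported in `S`.
[cite: Neuberger2000Bounds, §Lower bound] -/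
theorem sq_sub_thirty_mul_le_eucNorm_sq_hoppingOp_mulVec (hF : ∀ μ, (F μ)ᴴ * F μ = 1)
    (hF' : ∀ μ, F μ * (F μ)ᴴ = 1)
    (hC : ∀ w : n → ℂ, (∀ p, w p ≠ 0 → S p) → ∀ μ ν : Fin 4, μ ≠ ν →
      eucNorm ((F μ * F ν - F ν * F μ) *ᵥ w) ≤ δ * eucNorm w ∧
      eucNorm ((F μ * (F ν)ᴴ - (F ν)ᴴ * F μ) *ᵥ w) ≤ δ * eucNorm w ∧
      eucNorm (((F μ)ᴴ * (F ν)ᴴ - (F ν)ᴴ * (F μ)ᴴ) *ᵥ w) ≤ δ * eucNorm w)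
    (hδ : 0 ≤ δ) (m : ℝ) (hm : -1 ≤ m)
    (v : n × Fin 4 → ℂ) (hv : ∀ p α, v (p, α) ≠ 0 → S p) :
    (m ^ 2 - 30 * δ) * eucNorm v ^ 2 ≤
      eucNorm
        ((((m + 4 : ℝ) : ℂ) • (1 : Matrix (n × Fin 4) (n × Fin 4) ℂ) -
          ∑ μ, (F μ ⊗ₖ chiralProjMinus μ + (F μ)ᴴ ⊗ₖ chiralProjPlus μ)) *ᵥ v) ^ 2 := by
  set e : Fin 4 → n × Fin 4 → ℂ :=
    fun μ => v - (F μ ⊗ₖ chiralProjMinus μ + (F μ)ᴴ ⊗ₖ chiralProjPlus μ) *ᵥ v with he_def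
  have ht : (((m + 4 : ℝ) : ℂ) • (1 : Matrix (n × Fin 4) (n × Fin 4) ℂ) -
      ∑ μ, (F μ ⊗ₖ chiralProjMinus μ + (F μ)ᴴ ⊗ₖ chiralProjPlus μ)) *ᵥ v =
      (m : ℂ) • v + ∑ μ, e μ := by
    rw [sub_mulVec, smul_mulVec, one_mulVec, sum_mulVec, he_def]
    simp only [Finset.sum_sub_distrib, Finset.sum_const, Finset.card_univ, Fintype.card_fin]
    rw [← Nat.cast_smul_eq_nsmul ℂ, Complex.ofReal_add, add_smul]
    push_cast
    abel
  have he : ∀ μ, 2 * (star v ⬝ᵥ e μ).re = eucNorm (e μ) ^ 2 := fun μ =>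
    eucNorm_sq_sub_isometry_mulVec _ (conjTranspose_Wk_mul_Wk F hF hF' μ) v
  rw [ht, eucNorm_sq_smul_add_sum v e m he]
  have hmid : 0 ≤ (m + 1) * ∑ μ, eucNorm (e μ) ^ 2 :=
    mul_nonneg (by linarith) (Finset.sum_nonneg fun μ _ => by positivity)
  have hoff : -(30 * (δ * eucNorm v ^ 2)) ≤ ∑ μ, ∑ ν ∈ univ.erase μ, (star (e μ) ⬝ᵥ e ν).re := by
    have hpair : ∀ μ, ∀ ν ∈ univ.erase μ,
        -(5 / 2 * (δ * eucNorm v ^ 2)) ≤ (star (e μ) ⬝ᵥ e ν).re := fun μ ν hν =>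
      re_sub_Wk_pair_ge F hF hF' hC hδ (Finset.ne_of_mem_erase hν).symm v hv
    calc -(30 * (δ * eucNorm v ^ 2))
        = ∑ _μ : Fin 4, ∑ _ν ∈ univ.erase _μ, -(5 / 2 * (δ * eucNorm v ^ 2)) := by
          simp only [Finset.sum_const, Finset.card_erase_of_mem (Finset.mem_univ _),
            Finset.card_univ, Fintype.card_fin]
          ring
      _ ≤ _ := Finset.sum_le_sum fun μ _ => Finset.sum_le_sum (hpair μ)
  nlinarith [hmid, hoff]

end MainAbstract

end Literature.MathematicalPhysics.QuantumLattice.NeubergerBound
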